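import Literature.NumberTheory.Automorphic.ArchKirillovODEGL2Real
import Literature.NumberTheory.Automorphic.WhittakerODEDecayingSolution
import Literature.NumberTheory.Automorphic.ArchGardingAffineConjGrowth
import HarnessLib

/-!
# The Kirillov function of a weight-zero Casimir eigenvector of `GL₂(K_∞)` along a real place is a
# `K`-Bessel function (Jacquet–Langlands (1970), §5; Bump (1997), Thm. 2.8.1; Goldfeld (2006), §3.4)

Topic `NumberTheory/Automorphic`; namespace `Literature.NumberTheory.Automorphic`. Theorems only (no
definition, no named fact, no instance). Fifth brick of the ARCHIMEDEAN Hecke theory of `GL(2)` in the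
tree's Gårding-space vocabulary, assembling

* `ArchKirillovODEGL2Real.kirillovODE_real` — the differential equation of `y ↦ ℓ(τ(exp yH₀) v)`,
* `ArchGardingAffineConjGrowth.exists_norm_apply_gardingAct_le` — its moderate growth,
* `WhittakerODEDecayingSolution.exists_eq_const_mul_exp_mul_besselMode_of_growth` — the moderately
  growing solutions of that equation are the multiples of `e^{μy/2} · besselMode a ν (e^y)`
  (`besselMode a ν u = 2 √u K_{iν}(a u)`, `MaassFormWhittakerModes`),
* `WhittakerODEDecayingSolution.integral_cpow_mul_besselMode_two_pi` — the Mellin transform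
  `∫₀^∞ u^{μ/2} besselMode 2π ν u · u^{s-3/2} du = ½ Γ_ℝ(s + μ/2 + iν) Γ_ℝ(s + μ/2 - iν)`
  (`BesselKMellinTransform`),

into the classical statement. Let `τ` be a strongly continuous representation of `G_∞ = GL₂(K_∞)` on a
Banach space by contractions (e.g. unitary), `𝒢` its Gårding space, `w` a REAL place of `K` with letters
`H₀ = E₀₀ ⊗ r_w`, `H₁ = E₁₁ ⊗ r_w`, `X⁺ = E₀₁ ⊗ r_w`, `X⁻ = E₁₀ ⊗ r_w` (`r_w` the idempotent of `K_w ⊆ K_∞`),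
`ℓ : 𝒢 → ℂ` a linear functional continuous for the `U(𝔤)`-seminorms with `ℓ(τ(X⁺) u) = θ ℓ(u)`,
`θ² = -a²`, `a > 0` (a continuous `ψ_∞`-Whittaker functional or a torus translate of one: `θ = ∓2πi c`,
`a = 2π|c|`), and `v ∈ 𝒢` with

  `τ(X⁺ - X⁻) v = 0` (weight `0` at `w`),  `τ(H₀) v + τ(H₁) v = μ v`,  `Σ_{i,j} τ(E_{ij} ⊗ r_w) τ(E_{ji} ⊗ r_w) v = λ v`.

Write `λ = μ²/2 - 2ν² - ½` (`ν ∈ ℂ`; for `τ_w = π(|·|^{s₁}, |·|^{s₂})`: `μ = s₁ + s₂`, `iν = ±(s₁ - s₂)/2`). Then: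

* `exists_norm_apply_gardingAct_expGL_le` — **moderate growth along the torus**:
  `|ℓ(τ(exp yH₀) v)| ≤ M e^{N|y|}` (any Gårding `v`, from `ArchGardingAffineConjGrowth` with
  `exp(yH₀) = 1 + (e^y - 1)H₀`);
* `exists_apply_gardingAct_expGL_eq_besselMode` — **the Kirillov function is a `K`-Bessel function**:
  there is `c ∈ ℂ` with

    `ℓ(τ(exp yH₀) v) = c · e^{μy/2} · besselMode a ν (e^y)`   for all `y ∈ ℝ`,

  i.e. `ℓ(τ(diag(u, 1)_w) v) = 2c u^{(μ+1)/2} K_{iν}(a u)` for `u > 0` (Jacquet–Langlands (1970), §5,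
  proof of Lemma 5.13.1 and Thm. 5.15: `W(a(u)) = |u|^{(s₁+s₂)/2} · u^{1/2} K_{(s₁-s₂)/2}(2π|u|)` up to a
  constant; Bump (1997), Thm. 2.8.1; Goldfeld (2006), §3.4);
* `exists_apply_gardingAct_expGL_eq_besselMode_and_mellin` — for `a = 2π` moreover
  **`∫₀^∞ ℓ(τ(diag(u,1)_w) v) u^{s-1/2} d^×u = (c/2) Γ_ℝ(s + μ/2 + iν) Γ_ℝ(s + μ/2 - iν)`** for
  `re(s + μ/2) > |im ν|` — the local archimedean `L`-factor `L(s, τ_w) = Γ_ℝ(s + s₁) Γ_ℝ(s + s₂)` of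
  Jacquet–Langlands (1970), Thm. 5.15 / Prop. 3.5 as the Mellin transform of the weight-zero Kirillov
  function (Bump (1997), §2.8; Gelbart (1975), Thm. 6.16).

## References

* H. Jacquet, R. P. Langlands, *Automorphic Forms on GL(2)*, LNM 114 (1970), §5, Lemma 5.13.1 and
  Thm. 5.15 (PDF pp. 120–129 of the held retypeset copy). [JacquetLanglands1970]
* D. Bump, *Automorphic Forms and Representations*, CUP 1997, §2.8, Thm. 2.8.1. [Bump1997]
* D. Goldfeld, *Automorphic Forms and L-Functions for the Group GL(n,ℝ)*, CUP 2006, §3.4. [Goldfeld2006]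
-/

noncomputable section

open MeasureTheory Measure NumberField NumberField.InfinitePlace NumberField.mixedEmbedding IsDedekindDomain Set Filter
open scoped MatrixGroups Topology Classical

namespace Literature.NumberTheory.Automorphic

variable {K : Type} [Field K] [NumberField K]

-- as in `ArchGardingWhittaker`
set_option backward.isDefEq.respectTransparency false

/-- `1 + |e^t - 1| ≤ e^{|t|}` (`t ≥ 0`: equality; `t ≤ 0`: `2 - e^t ≤ e^{-t}`, i.e. `2 ≤ 2 cosh t`). [folklore] -/
theorem one_add_abs_exp_sub_one_le (t : ℝ) : 1 + |Real.exp t - 1| ≤ Real.exp |t| := by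
  rcases le_total 0 t with ht | ht
  · rw [abs_of_nonneg ht, abs_of_nonneg (by linarith [Real.one_le_exp ht])]
    linarith
  · rw [abs_of_nonpos ht, abs_of_nonpos (by linarith [Real.exp_le_one_iff.mpr ht])]
    have h := Real.one_le_cosh t
    rw [Real.cosh_eq] at h
    linarith

section RealPlace

variable {hcpt : isCompact_glFiniteIntegralLevel 2 K}
  {E : Type*} [NormedAddCommGroup E] [NormedSpace ℂ E] [CompleteSpace E]
  {τ : ContRepresentation ℂ (AutomorphyDatum.gl 2 K hcpt).arch.carrier E}
  (hτ : τ.IsStronglyContinuous) (w : {w : InfinitePlace K // IsReal w})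

local notation "H₀" => Matrix.single (0 : Fin 2) (0 : Fin 2) ((Pi.single w 1, 0) : mixedSpace K)
local notation "H₁" => Matrix.single (1 : Fin 2) (1 : Fin 2) ((Pi.single w 1, 0) : mixedSpace K)
local notation "X⁺" => Matrix.single (0 : Fin 2) (1 : Fin 2) ((Pi.single w 1, 0) : mixedSpace K)
local notation "X⁻" => Matrix.single (1 : Fin 2) (0 : Fin 2) ((Pi.single w 1, 0) : mixedSpace K)
local notation "D" => gardingEnd (hcpt := hcpt) (τ := τ) hτ
local notation "A[" y "]" => gardingAct (hcpt := hcpt) (τ := τ) hτ (expGL ((y : ℝ) • H₀))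

/-- **Moderate growth of Kirillov functions along the torus of a real place**: for `τ` acting by
contractions, `ℓ` continuous for the `U(𝔤)`-seminorms and any Gårding vector `v`,
`|ℓ(τ(exp yH₀) v)| ≤ M e^{N|y|}` for all `y ∈ ℝ` (`exp(yH₀) = 1 + (e^{y} - 1)H₀`,
`exp(yH₀)⁻¹ = 1 + (e^{-y} - 1)H₀` and `ArchGardingAffineConjGrowth.exists_norm_apply_gardingAct_le`).
[cite: JacquetLanglands1970, §5, proof of Lemma 5.13.1] -/
theorem exists_norm_apply_gardingAct_expGL_le (hτb : ∀ g, ‖(τ g : E →L[ℂ] E)‖ ≤ 1)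
    {ℓ : archGardingSpace hcpt τ →ₗ[ℂ] ℂ}
    (hℓ : ∃ (C : ℝ) (𝒮 : Finset (List (Matrix (Fin 2) (Fin 2) (mixedSpace K)))), 0 ≤ C ∧
      ∀ v : archGardingSpace hcpt τ, ‖ℓ v‖ ≤ C * ∑ w ∈ 𝒮, ‖archWordDerivE hcpt τ w v‖)
    (v : archGardingSpace hcpt τ) :
    ∃ (M : ℝ) (N : ℕ), 0 ≤ M ∧ ∀ y : ℝ, ‖ℓ (A[y] v)‖ ≤ M * Real.exp (N * |y|) := by
  obtain ⟨M, N, hM, hb⟩ := exists_norm_apply_gardingAct_le hτ hτb hℓ H₀ v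
  refine ⟨M, 2 * N, hM, fun y => ?_⟩
  have h := hb (expGL (y • H₀)) (Real.exp (-y) - 1) (Real.exp y - 1) (coe_expGL_smul_hZero_inv w y)
    (coe_expGL_smul_hZero w y)
  have key : (1 + |Real.exp (-y) - 1|) * (1 + |Real.exp y - 1|) ≤ Real.exp |y| ^ 2 := by
    have h1 := one_add_abs_exp_sub_one_le (-y)
    rw [abs_neg] at h1
    have h2 := one_add_abs_exp_sub_one_le y
    have h0 : 0 ≤ 1 + |Real.exp (-y) - 1| := by positivity
    nlinarith
  calc ‖ℓ (A[y] v)‖ ≤ ((1 + |Real.exp (-y) - 1|) * (1 + |Real.exp y - 1|)) ^ N * M := h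
    _ ≤ (Real.exp |y| ^ 2) ^ N * M := by gcongr
    _ = M * Real.exp ((2 * N : ℕ) * |y|) := by rw [Real.exp_nat_mul, pow_mul, mul_comm]

/-- **The Kirillov function of a weight-zero Casimir eigenvector along a real place is a `K`-Bessel
function** (Jacquet–Langlands (1970), §5; Bump (1997), Thm. 2.8.1). Let `τ` act by contractions, let
`ℓ` be continuous for the `U(𝔤)`-seminorms with `ℓ(τ(X⁺) u) = θ ℓ(u)`, `θ² = -a²`, `a > 0`, and let
`v ∈ 𝒢` have weight `0` at `w` (`τ(X⁺ - X⁻) v = 0`), central parameter `μ` (`τ(H₀) v + τ(H₁) v = μ v`) and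
Casimir eigenvalue `λ = μ²/2 - 2ν² - ½` (`Σ τ(E_{ij}) τ(E_{ji}) v = λ v`). Then for some `c ∈ ℂ`,
`ℓ(τ(exp yH₀) v) = c e^{μy/2} besselMode a ν (e^y)` for all `y`, i.e.
`ℓ(τ(diag(u,1)_w) v) = 2c u^{(μ+1)/2} K_{iν}(a u)` (`u > 0`). Proof: the function satisfies the
differential equation `kirillovODE_real` (with `k = 0`), grows at most exponentially in `y`
(`exists_norm_apply_gardingAct_expGL_le`), hence is the decaying solution
(`exists_eq_const_mul_exp_mul_besselMode_of_growth`).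
[cite: JacquetLanglands1970, §5, Lemma 5.13.1 and Thm. 5.15] [cite: Bump1997, Thm. 2.8.1] -/
theorem exists_apply_gardingAct_expGL_eq_besselMode (hτb : ∀ g, ‖(τ g : E →L[ℂ] E)‖ ≤ 1)
    {ℓ : archGardingSpace hcpt τ →ₗ[ℂ] ℂ}
    (hℓ : ∃ (C : ℝ) (𝒮 : Finset (List (Matrix (Fin 2) (Fin 2) (mixedSpace K)))), 0 ≤ C ∧
      ∀ v : archGardingSpace hcpt τ, ‖ℓ v‖ ≤ C * ∑ w ∈ 𝒮, ‖archWordDerivE hcpt τ w v‖)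
    {θ : ℂ} (hθ : ∀ u : archGardingSpace hcpt τ, ℓ (D X⁺ u) = θ * ℓ u)
    {a : ℝ} (ha : 0 < a) (hθa : θ ^ 2 = -((a : ℂ) ^ 2))
    (μ lam ν : ℂ) (hlam : lam = μ ^ 2 / 2 - 2 * ν ^ 2 - 1 / 2) (v : archGardingSpace hcpt τ)
    (hW : D (X⁺ - X⁻) v = 0) (hZ : D H₀ v + D H₁ v = μ • v)
    (hC : ∑ i : Fin 2, ∑ j : Fin 2, D (Matrix.single i j ((Pi.single w 1, 0) : mixedSpace K))
        (D (Matrix.single j i ((Pi.single w 1, 0) : mixedSpace K)) v) = lam • v) :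
    ∃ c : ℂ, ∀ y : ℝ, ℓ (A[y] v) = c * (Real.exp y : ℂ) ^ (μ / 2) * besselMode a ν (Real.exp y) := by
  -- the differential equation (`k = 0`)
  have hW' : D (X⁺ - X⁻) v = (Complex.I * 0) • v := by rw [hW, mul_zero, zero_smul]
  have hode : ∀ y : ℝ, 2 * ℓ (A[y] (D H₀ (D H₀ v))) - (2 * μ + 2) * ℓ (A[y] (D H₀ v)) +
      (μ ^ 2 + μ - lam) * ℓ (A[y] v) + 2 * θ ^ 2 * (Real.exp y : ℂ) ^ 2 * ℓ (A[y] v) = 0 := fun y => by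
    have h := kirillovODE_real hτ w hθ 0 μ lam v hW' hZ hC y
    linear_combination h
  -- derivatives
  have hf : ∀ y : ℝ, HasDerivAt (fun x : ℝ => ℓ (A[x] v)) (ℓ (A[y] (D H₀ v))) y :=
    fun y => hasDerivAt_apply_gardingAct_expGL hτ w hℓ v y
  have hf₁ : ∀ y : ℝ, HasDerivAt (fun x : ℝ => ℓ (A[x] (D H₀ v))) (ℓ (A[y] (D H₀ (D H₀ v)))) y :=
    fun y => hasDerivAt_apply_gardingAct_expGL hτ w hℓ (D H₀ v) y
  -- growth
  obtain ⟨M, N, -, hgrow⟩ := exists_norm_apply_gardingAct_expGL_le hτ w hτb hℓ v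
  have hgrow' : ∀ y : ℝ, 0 ≤ y → ‖ℓ (A[y] v)‖ ≤ M * Real.exp ((N : ℝ) * y) := fun y hy => by
    have h := hgrow y
    rwa [abs_of_nonneg hy] at h
  have hν : ν ^ 2 + 1 / 4 = (μ ^ 2 + μ - lam) / 2 - μ ^ 2 / 4 - μ / 2 := by rw [hlam]; ring
  exact exists_eq_const_mul_exp_mul_besselMode_of_growth (f := fun x : ℝ => ℓ (A[x] v))
    (f₁ := fun x : ℝ => ℓ (A[x] (D H₀ v))) (f₂ := fun x : ℝ => ℓ (A[x] (D H₀ (D H₀ v)))) hf hf₁ ha hθa hode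
    hgrow' ν hν

/-- **The weight-zero Kirillov function and its Mellin transform = the archimedean `L`-factor** (the case
`a = 2π` of `exists_apply_gardingAct_expGL_eq_besselMode`, e.g. `ℓ` a continuous `ψ_∞`-Whittaker
functional, `θ = dψ_∞(X⁺) = ∓2πi`): there is `c ∈ ℂ` with
`ℓ(τ(exp yH₀) v) = c e^{μy/2} besselMode 2π ν (e^y)` for all `y ∈ ℝ` AND, for `re(s + μ/2) > |im ν|`,

  `∫₀^∞ ℓ(τ(exp((log u) H₀)) v) u^{s - 1/2} du/u = (c/2) Γ_ℝ(s + μ/2 + iν) Γ_ℝ(s + μ/2 - iν)`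

(Jacquet–Langlands (1970), Thm. 5.15 with Prop. 3.5: `L(s, π(|·|^{s₁}, |·|^{s₂})) = Γ_ℝ(s + s₁) Γ_ℝ(s + s₂)`,
`μ = s₁ + s₂`, `iν = (s₁ - s₂)/2`; Bump (1997), §2.8).
[cite: JacquetLanglands1970, Thm. 5.15 and Prop. 3.5] [cite: Bump1997, §2.8, Thm. 2.8.1] -/
theorem exists_apply_gardingAct_expGL_eq_besselMode_and_mellin (hτb : ∀ g, ‖(τ g : E →L[ℂ] E)‖ ≤ 1)
    {ℓ : archGardingSpace hcpt τ →ₗ[ℂ] ℂ}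
    (hℓ : ∃ (C : ℝ) (𝒮 : Finset (List (Matrix (Fin 2) (Fin 2) (mixedSpace K)))), 0 ≤ C ∧
      ∀ v : archGardingSpace hcpt τ, ‖ℓ v‖ ≤ C * ∑ w ∈ 𝒮, ‖archWordDerivE hcpt τ w v‖)
    {θ : ℂ} (hθ : ∀ u : archGardingSpace hcpt τ, ℓ (D X⁺ u) = θ * ℓ u)
    (hθπ : θ ^ 2 = -(((2 * Real.pi : ℝ) : ℂ) ^ 2))
    (μ lam ν : ℂ) (hlam : lam = μ ^ 2 / 2 - 2 * ν ^ 2 - 1 / 2) (v : archGardingSpace hcpt τ)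
    (hW : D (X⁺ - X⁻) v = 0) (hZ : D H₀ v + D H₁ v = μ • v)
    (hC : ∑ i : Fin 2, ∑ j : Fin 2, D (Matrix.single i j ((Pi.single w 1, 0) : mixedSpace K))
        (D (Matrix.single j i ((Pi.single w 1, 0) : mixedSpace K)) v) = lam • v) :
    ∃ c : ℂ, (∀ y : ℝ, ℓ (A[y] v) = c * (Real.exp y : ℂ) ^ (μ / 2) * besselMode (2 * Real.pi) ν (Real.exp y)) ∧
      ∀ s : ℂ, |ν.im| < (s + μ / 2).re →
        ∫ u in Ioi (0 : ℝ), ℓ (A[Real.log u] v) * (u : ℂ) ^ (s - 1 / 2 - 1) =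
          c * ((1 / 2 : ℂ) * (Complex.Gammaℝ (s + μ / 2 + Complex.I * ν) * Complex.Gammaℝ (s + μ / 2 - Complex.I * ν))) := by
  obtain ⟨c, hc⟩ := exists_apply_gardingAct_expGL_eq_besselMode hτ w hτb hℓ hθ Real.two_pi_pos hθπ μ lam ν hlam
    v hW hZ hC
  refine ⟨c, hc, fun s hs => ?_⟩
  rw [← integral_cpow_mul_besselMode_two_pi hs, ← MeasureTheory.integral_const_mul]
  refine setIntegral_congr_fun measurableSet_Ioi fun u hu => ?_
  rw [hc (Real.log u), Real.exp_log hu]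
  ring

end RealPlace

end Literature.NumberTheory.Automorphic
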